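import Literature.MathematicalPhysics.KineticTheory.HardSphereUniformGas
import Summits.AtomisticToContinuum.HydrodynamicLimit.Theorems.JParityClosureEvenStressEnskogRung0LocalStatisticsHelpers
import HarnessLib

/-!
# One-body deviation at rung 0 (stub S3b2 `stub_oneBodyDeviationRung0` of the line
# `preshock-kinetic-slaving`, crux `JParityClosure.EvenStressEnskog`, stmt-AtomisticToContinuum-13079)
# — helper file 2: velocity truncation and the `∫⁻` bookkeeping

Model-free ingredients of the `L¹` smallness of the window deviation at one centre:

* `exists_uniformModulus_prod`: a continuous `F(v, p)` is uniformly continuous in the parameter `p`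
  for `‖v‖ ≤ L` (compactness of `closedBall 0 L ×ˢ closedBall p₀ 1`);
* the continuous tail weight `ψ_L(v) = C (2 + 2‖v‖² + c) · min 1 (‖v‖²/L²)`: continuity, quadratic
  growth, the truncation estimate `|F(v, p) − F(v, p₀)| ≤ ε' + ψ_L(v)` (`abs_sub_le_add_velTailWeight`),
  and `∫ ψ_L dN(u, θ id) ≤ M/L²` by the Gaussian fourth moment (`exists_integral_velTailWeight_le`);
* `abs_avg_mul_le_of_abs_le_add`: `|(n⁻¹) Σ bᵢ dᵢ| ≤ ε' (n⁻¹ Σ bᵢ) + n⁻¹ Σ bᵢ ψᵢ` when `|dᵢ| ≤ ε' + ψᵢ`, `bᵢ ≥ 0`;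
* `exists_lintegral_abs_le_of_split`: the `ε`-bookkeeping — if
  `|D_N| ≤ c₀ + |T_N| + |T'_N| + 1_{Bad_N} (c₁ + c₂ V_N)` pointwise with `E T_N² → 0`, `E T'_N² → 0`,
  `P_N(Bad_N) → 0` and `E V_N² ≤ K`, then `E |D_N| ≤ c₀ + η` for `N` large (`|y| ≤ κ + y²/(4κ)`,
  `1_Bad V ≤ (λ/2) 1_Bad + V²/(2λ)`, everything in `∫⁻` form).

References: standard real analysis; H. Spohn, *Large Scale Dynamics of Interacting Particles* (1991),
Part I §2.3 for the setting.
-/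

noncomputable section

open MeasureTheory ProbabilityTheory Filter Set Topology
open scoped ENNReal InnerProductSpace BigOperators

namespace Summit.AtomisticToContinuum.HydrodynamicLimit.Theorems.EvenStressEnskog

open Literature.Analysis.FluidPDE Literature.MathematicalPhysics.KineticTheory

/-! ## Uniform continuity in the parameter on velocity balls -/

/-- **Uniform modulus in the parameter.**  For a continuous `F : V3 × (V3 × ℝ) → ℝ`, `L` and `p₀`,
every `ε > 0` admits `ι ∈ (0, 1]` with `|F(v, p) − F(v, p₀)| < ε` whenever `‖v‖ ≤ L` and
`dist p p₀ < ι` (uniform continuity on the compact `closedBall 0 L ×ˢ closedBall p₀ 1`). [folklore] -/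
theorem exists_uniformModulus_prod {F : V3 × V3 × ℝ → ℝ} (hF : Continuous F) (L : ℝ) (p₀ : V3 × ℝ)
    {ε : ℝ} (hε : 0 < ε) :
    ∃ ι : ℝ, 0 < ι ∧ ι ≤ 1 ∧
      ∀ v : V3, ‖v‖ ≤ L → ∀ p : V3 × ℝ, dist p p₀ < ι → |F (v, p) - F (v, p₀)| < ε := by
  have hK : IsCompact (Metric.closedBall (0 : V3) L ×ˢ Metric.closedBall p₀ 1) :=
    (isCompact_closedBall _ _).prod (isCompact_closedBall _ _)
  obtain ⟨δ, hδ, hδF⟩ := Metric.uniformContinuousOn_iff.1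
    (hK.uniformContinuousOn_of_continuous hF.continuousOn) ε hε
  refine ⟨min δ 1, lt_min hδ one_pos, min_le_right _ _, fun v hv p hp => ?_⟩
  have hvK : v ∈ Metric.closedBall (0 : V3) L := mem_closedBall_zero_iff.2 hv
  have hpK : (v, p) ∈ Metric.closedBall (0 : V3) L ×ˢ Metric.closedBall p₀ 1 :=
    ⟨hvK, Metric.mem_closedBall.2 (hp.le.trans (min_le_right _ _))⟩
  have hp0K : (v, p₀) ∈ Metric.closedBall (0 : V3) L ×ˢ Metric.closedBall p₀ 1 :=
    ⟨hvK, Metric.mem_closedBall_self zero_le_one⟩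
  have hd : dist (v, p) (v, p₀) < δ := by
    rw [Prod.dist_eq, dist_self]
    exact max_lt hδ (hp.trans_le (min_le_left _ _))
  have h := hδF (v, p) hpK (v, p₀) hp0K hd
  rwa [Real.dist_eq] at h

/-! ## The continuous tail weight -/

/-- The tail weight `ψ_L(v) = C (2 + 2‖v‖² + c) min(1, ‖v‖²/L²)` is continuous. [folklore] -/
theorem continuous_velTailWeight (C c L : ℝ) :
    Continuous fun v : V3 => C * (2 + 2 * ‖v‖ ^ 2 + c) * min 1 (‖v‖ ^ 2 / L ^ 2) := by
  fun_prop

/-- The tail weight is nonnegative (`C, c ≥ 0`). [folklore] -/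
theorem velTailWeight_nonneg {C c : ℝ} (hC : 0 ≤ C) (hc : 0 ≤ c) (L : ℝ) (v : V3) :
    0 ≤ C * (2 + 2 * ‖v‖ ^ 2 + c) * min 1 (‖v‖ ^ 2 / L ^ 2) :=
  mul_nonneg (mul_nonneg hC (by positivity)) (le_min zero_le_one (by positivity))

/-- The tail weight has quadratic growth: `|ψ_L(v)| ≤ C (2 + c) (1 + ‖v‖²)` (`C, c ≥ 0`). [folklore] -/
theorem abs_velTailWeight_le {C c : ℝ} (hC : 0 ≤ C) (hc : 0 ≤ c) (L : ℝ) (v : V3) :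
    |C * (2 + 2 * ‖v‖ ^ 2 + c) * min 1 (‖v‖ ^ 2 / L ^ 2)| ≤ C * (2 + c) * (1 + ‖v‖ ^ 2) := by
  rw [abs_of_nonneg (velTailWeight_nonneg hC hc L v)]
  have h1 : min 1 (‖v‖ ^ 2 / L ^ 2) ≤ 1 := min_le_left _ _
  have h2 : 2 + 2 * ‖v‖ ^ 2 + c ≤ (2 + c) * (1 + ‖v‖ ^ 2) := by nlinarith [sq_nonneg ‖v‖]
  calc C * (2 + 2 * ‖v‖ ^ 2 + c) * min 1 (‖v‖ ^ 2 / L ^ 2)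
      ≤ C * (2 + 2 * ‖v‖ ^ 2 + c) * 1 :=
        mul_le_mul_of_nonneg_left h1 (mul_nonneg hC (by positivity))
    _ ≤ C * ((2 + c) * (1 + ‖v‖ ^ 2)) * 1 := by gcongr
    _ = C * (2 + c) * (1 + ‖v‖ ^ 2) := by ring

/-- Beyond the truncation radius the tail weight is the full quadratic majorant:
`ψ_L(v) = C (2 + 2‖v‖² + c)` for `‖v‖ ≥ L > 0`. [folklore] -/
theorem velTailWeight_eq_of_le {C c L : ℝ} (hL : 0 < L) {v : V3} (hv : L ≤ ‖v‖) :
    C * (2 + 2 * ‖v‖ ^ 2 + c) * min 1 (‖v‖ ^ 2 / L ^ 2) = C * (2 + 2 * ‖v‖ ^ 2 + c) := by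
  have h : 1 ≤ ‖v‖ ^ 2 / L ^ 2 := by
    rw [one_le_div (by positivity)]
    exact pow_le_pow_left₀ hL.le hv 2
  rw [min_eq_left h, mul_one]

/-- **Truncation estimate.**  If `|F(v, u', θ')| ≤ C(1 + ‖v‖² + ‖u'‖² + |θ'|)`, `‖u'‖ ≤ ‖u‖ + 1`,
`|θ'| ≤ |θ| + 1`, and `|F(v, u', θ') − F(v, u, θ)| < ε'` for `‖v‖ ≤ L`, then for EVERY `v`
`|F(v, u', θ') − F(v, u, θ)| ≤ ε' + ψ_L(v)` with `c = (‖u‖+1)² + (|θ|+1) + ‖u‖² + |θ|`. [folklore] -/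
theorem abs_sub_le_add_velTailWeight {F : V3 × V3 × ℝ → ℝ} {C : ℝ}
    (hC : ∀ q, |F q| ≤ C * (1 + ‖q.1‖ ^ 2 + ‖q.2.1‖ ^ 2 + |q.2.2|)) (hC0 : 0 ≤ C)
    {u u' : V3} {θ θ' L ε' : ℝ} (hL : 0 < L) (hε' : 0 ≤ ε')
    (hu' : ‖u'‖ ≤ ‖u‖ + 1) (hθ' : |θ'| ≤ |θ| + 1)
    (hmod : ∀ v : V3, ‖v‖ ≤ L → |F (v, u', θ') - F (v, u, θ)| < ε') (v : V3) :
    |F (v, u', θ') - F (v, u, θ)| ≤ ε' + C * (2 + 2 * ‖v‖ ^ 2 +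
      ((‖u‖ + 1) ^ 2 + (|θ| + 1) + ‖u‖ ^ 2 + |θ|)) * min 1 (‖v‖ ^ 2 / L ^ 2) := by
  have hc : 0 ≤ (‖u‖ + 1) ^ 2 + (|θ| + 1) + ‖u‖ ^ 2 + |θ| := by positivity
  rcases le_or_gt ‖v‖ L with hv | hv
  · exact ((hmod v hv).le.trans (le_add_of_nonneg_right (velTailWeight_nonneg hC0 hc L v)))
  · rw [velTailWeight_eq_of_le hL hv.le]
    have h1 := hC (v, u', θ')
    have h2 := hC (v, u, θ)
    have hu2 : ‖u'‖ ^ 2 ≤ (‖u‖ + 1) ^ 2 := pow_le_pow_left₀ (norm_nonneg _) hu' 2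
    calc |F (v, u', θ') - F (v, u, θ)| ≤ |F (v, u', θ')| + |F (v, u, θ)| := abs_sub _ _
      _ ≤ C * (1 + ‖v‖ ^ 2 + ‖u'‖ ^ 2 + |θ'|) + C * (1 + ‖v‖ ^ 2 + ‖u‖ ^ 2 + |θ|) :=
          add_le_add h1 h2
      _ ≤ C * (1 + ‖v‖ ^ 2 + (‖u‖ + 1) ^ 2 + (|θ| + 1)) + C * (1 + ‖v‖ ^ 2 + ‖u‖ ^ 2 + |θ|) := by
          gcongr
      _ = C * (2 + 2 * ‖v‖ ^ 2 + ((‖u‖ + 1) ^ 2 + (|θ| + 1) + ‖u‖ ^ 2 + |θ|)) := by ring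
      _ ≤ ε' + C * (2 + 2 * ‖v‖ ^ 2 + ((‖u‖ + 1) ^ 2 + (|θ| + 1) + ‖u‖ ^ 2 + |θ|)) :=
          le_add_of_nonneg_left hε'

/-- **The tail weight has small Gaussian integral**: there is `M ≥ 0` (the Gaussian integral of
`C(2 + 2‖v‖² + c)‖v‖²`, finite by the fourth moment) with `∫ ψ_L dN(u, θ id) ≤ M / L²` for every
`L > 0`. [folklore] -/
theorem exists_integral_velTailWeight_le :
    ∀ {C c : ℝ}, 0 ≤ C → 0 ≤ c → ∀ (u : V3) (θ : ℝ), ∃ M : ℝ, 0 ≤ M ∧ ∀ L : ℝ, 0 < L →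
      ∫ v, C * (2 + 2 * ‖v‖ ^ 2 + c) * min 1 (‖v‖ ^ 2 / L ^ 2) ∂gaussMeasure u θ ≤ M / L ^ 2 := by
  intro C c hC hc u θ
  have h2 : Integrable (fun v : V3 => ‖v‖ ^ 2) (gaussMeasure u θ) :=
    (IsGaussian.memLp_id _ 2 (by simp)).integrable_norm_pow (by norm_num)
  have h4 : Integrable (fun v : V3 => ‖v‖ ^ 4) (gaussMeasure u θ) :=
    (IsGaussian.memLp_id _ 4 (by simp)).integrable_norm_pow (by norm_num)
  have hgeq : (fun v : V3 => C * (2 + 2 * ‖v‖ ^ 2 + c) * ‖v‖ ^ 2) =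
      fun v => C * (2 + c) * ‖v‖ ^ 2 + 2 * C * ‖v‖ ^ 4 := by
    funext v
    ring
  have hg : Integrable (fun v : V3 => C * (2 + 2 * ‖v‖ ^ 2 + c) * ‖v‖ ^ 2) (gaussMeasure u θ) := by
    rw [hgeq]
    exact (h2.const_mul _).add (h4.const_mul _)
  refine ⟨∫ v, C * (2 + 2 * ‖v‖ ^ 2 + c) * ‖v‖ ^ 2 ∂gaussMeasure u θ,
    integral_nonneg fun v => by positivity, fun L hL => ?_⟩
  have hpt : ∀ v : V3, C * (2 + 2 * ‖v‖ ^ 2 + c) * min 1 (‖v‖ ^ 2 / L ^ 2) ≤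
      C * (2 + 2 * ‖v‖ ^ 2 + c) * ‖v‖ ^ 2 / L ^ 2 := fun v => by
    rw [mul_div_assoc]
    exact mul_le_mul_of_nonneg_left (min_le_right _ _) (mul_nonneg hC (by positivity))
  have hψ : Integrable (fun v : V3 => C * (2 + 2 * ‖v‖ ^ 2 + c) * min 1 (‖v‖ ^ 2 / L ^ 2))
      (gaussMeasure u θ) := by
    refine (hg.div_const (L ^ 2)).mono' (continuous_velTailWeight C c L).aestronglyMeasurable
      (ae_of_all _ fun v => ?_)
    rw [Real.norm_eq_abs, abs_of_nonneg (velTailWeight_nonneg hC hc L v)]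
    exact hpt v
  calc ∫ v, C * (2 + 2 * ‖v‖ ^ 2 + c) * min 1 (‖v‖ ^ 2 / L ^ 2) ∂gaussMeasure u θ
      ≤ ∫ v, C * (2 + 2 * ‖v‖ ^ 2 + c) * ‖v‖ ^ 2 / L ^ 2 ∂gaussMeasure u θ :=
        integral_mono hψ (hg.div_const (L ^ 2)) hpt
    _ = (∫ v, C * (2 + 2 * ‖v‖ ^ 2 + c) * ‖v‖ ^ 2 ∂gaussMeasure u θ) / L ^ 2 := integral_div _ _

/-! ## Weighted averages -/

/-- `|n⁻¹ Σ bᵢ dᵢ| ≤ ε' (n⁻¹ Σ bᵢ) + n⁻¹ Σ bᵢ ψᵢ` when `bᵢ ≥ 0`, `|dᵢ| ≤ ε' + ψᵢ` and the prefactor is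
nonnegative. [folklore] -/
theorem abs_avg_mul_le_of_abs_le_add {n : ℕ} {a : ℝ} (ha : 0 ≤ a) (b d ψ : Fin n → ℝ) (hb : ∀ i, 0 ≤ b i)
    {ε' : ℝ} (hd : ∀ i, |d i| ≤ ε' + ψ i) :
    |a * ∑ i, b i * d i| ≤ ε' * (a * ∑ i, b i) + a * ∑ i, b i * ψ i := by
  rw [abs_mul, abs_of_nonneg ha]
  have h : |∑ i, b i * d i| ≤ ∑ i, b i * (ε' + ψ i) :=
    (Finset.abs_sum_le_sum_abs _ _).trans (Finset.sum_le_sum fun i _ => by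
      rw [abs_mul, abs_of_nonneg (hb i)]
      exact mul_le_mul_of_nonneg_left (hd i) (hb i))
  have hid : ∑ i, b i * (ε' + ψ i) = ε' * ∑ i, b i + ∑ i, b i * ψ i := by
    rw [Finset.mul_sum, ← Finset.sum_add_distrib]
    exact Finset.sum_congr rfl fun i _ => by ring
  calc a * |∑ i, b i * d i| ≤ a * ∑ i, b i * (ε' + ψ i) := mul_le_mul_of_nonneg_left h ha
    _ = ε' * (a * ∑ i, b i) + a * ∑ i, b i * ψ i := by rw [hid]; ring

/-! ## The `∫⁻` bookkeeping -/

/-- `Σ ofReal rᵢ = ofReal (Σ rᵢ)` for `rᵢ ≥ 0` (five terms). [folklore] -/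
theorem ofReal_add_five {r₀ r₁ r₂ r₃ r₄ : ℝ} (h₀ : 0 ≤ r₀) (h₁ : 0 ≤ r₁) (h₂ : 0 ≤ r₂)
    (h₃ : 0 ≤ r₃) (h₄ : 0 ≤ r₄) :
    ENNReal.ofReal r₀ + ENNReal.ofReal r₁ + ENNReal.ofReal r₂ + ENNReal.ofReal r₃ +
      ENNReal.ofReal r₄ = ENNReal.ofReal (r₀ + r₁ + r₂ + r₃ + r₄) := by
  rw [← ENNReal.ofReal_add h₀ h₁, ← ENNReal.ofReal_add (by positivity) h₂,
    ← ENNReal.ofReal_add (by positivity) h₃, ← ENNReal.ofReal_add (by positivity) h₄]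

/-- `ofReal d ≤ Σ ofReal rᵢ` from `d ≤ Σ rᵢ` with `rᵢ ≥ 0` (five terms). [folklore] -/
theorem ofReal_le_add_five {d r₀ r₁ r₂ r₃ r₄ : ℝ} (h₀ : 0 ≤ r₀) (h₁ : 0 ≤ r₁) (h₂ : 0 ≤ r₂)
    (h₃ : 0 ≤ r₃) (h₄ : 0 ≤ r₄) (h : d ≤ r₀ + r₁ + r₂ + r₃ + r₄) :
    ENNReal.ofReal d ≤ ENNReal.ofReal r₀ + ENNReal.ofReal r₁ + ENNReal.ofReal r₂ +
      ENNReal.ofReal r₃ + ENNReal.ofReal r₄ := by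
  rw [ofReal_add_five h₀ h₁ h₂ h₃ h₄]
  exact ENNReal.ofReal_le_ofReal h

/-- `y ≤ λ/2 + y²/(2λ)` for `λ > 0` (AM–GM). [folklore] -/
theorem le_half_add_sq_div_two_mul {y lam : ℝ} (hlam : 0 < lam) : y ≤ lam / 2 + y ^ 2 / (2 * lam) := by
  rw [← sub_nonneg]
  have e : lam / 2 + y ^ 2 / (2 * lam) - y = (y - lam) ^ 2 / (2 * lam) := by
    field_simp
    ring
  rw [e]
  positivity

/-- **`ε`-bookkeeping of the deviation.**  On probability spaces `(Ω_N, P_N)`: if pointwise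
`|D_N| ≤ c₀ + |T_N| + |T'_N| + 1_{Bad_N}(c₁ + c₂ V_N)` with `c₀, c₁, c₂, K ≥ 0`,
`∫⁻ T_N² → 0`, `∫⁻ T'_N² → 0`, `P_N(Bad_N) → 0` and `∫⁻ V_N² ≤ K`, then for every `η > 0`,
`∫⁻ |D_N| dP_N ≤ c₀ + η` for all large `N`. [folklore] -/
theorem exists_lintegral_abs_le_of_split {Ω : ℕ → Type*} [∀ N, MeasurableSpace (Ω N)]
    (P : (N : ℕ) → Measure (Ω N)) (hP : ∀ N, IsProbabilityMeasure (P N))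
    (D T T' V : (N : ℕ) → Ω N → ℝ) (Bad : (N : ℕ) → Set (Ω N))
    (hT : ∀ N, Measurable (T N)) (hT' : ∀ N, Measurable (T' N)) (hV : ∀ N, Measurable (V N))
    (hBad : ∀ N, MeasurableSet (Bad N))
    {c₀ c₁ c₂ K : ℝ} (hc₀ : 0 ≤ c₀) (hc₁ : 0 ≤ c₁) (hc₂ : 0 ≤ c₂) (hK : 0 ≤ K)
    (hD : ∀ N w, |D N w| ≤ c₀ + |T N w| + |T' N w| + (Bad N).indicator (fun w => c₁ + c₂ * V N w) w)
    (hTlim : Tendsto (fun N => ∫⁻ w, ENNReal.ofReal (T N w ^ 2) ∂P N) atTop (𝓝 0))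
    (hT'lim : Tendsto (fun N => ∫⁻ w, ENNReal.ofReal (T' N w ^ 2) ∂P N) atTop (𝓝 0))
    (hBadlim : Tendsto (fun N => P N (Bad N)) atTop (𝓝 0))
    (hVK : ∀ N, ∫⁻ w, ENNReal.ofReal (V N w ^ 2) ∂P N ≤ ENNReal.ofReal K)
    {η : ℝ} (hη : 0 < η) :
    ∃ N₀ : ℕ, ∀ N : ℕ, N₀ ≤ N → ∫⁻ w, ENNReal.ofReal |D N w| ∂P N ≤ ENNReal.ofReal (c₀ + η) := by
  -- the parameters
  set κ : ℝ := η / 8 with hκ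
  have hκ0 : 0 < κ := by positivity
  set lam : ℝ := 4 * c₂ * K / η + 1 with hlam
  have hlam0 : 0 < lam := by positivity
  have hlamη : η * lam = 4 * c₂ * K + η := by
    rw [hlam]
    field_simp
  set c₃ : ℝ := c₁ + c₂ * (lam / 2) with hc₃
  have hc₃0 : 0 ≤ c₃ := by positivity
  -- the thresholds
  obtain ⟨N₁, hN₁⟩ := ENNReal.tendsto_atTop_zero.1 hTlim (ENNReal.ofReal (κ * (η / 2)))
    (ENNReal.ofReal_pos.2 (by positivity))
  obtain ⟨N₂, hN₂⟩ := ENNReal.tendsto_atTop_zero.1 hT'lim (ENNReal.ofReal (κ * (η / 2)))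
    (ENNReal.ofReal_pos.2 (by positivity))
  obtain ⟨N₃, hN₃⟩ := ENNReal.tendsto_atTop_zero.1 hBadlim (ENNReal.ofReal (η / (8 * (c₃ + 1))))
    (ENNReal.ofReal_pos.2 (by positivity))
  refine ⟨max N₁ (max N₂ N₃), fun N hN => ?_⟩
  have hN1 : N ≥ N₁ := le_trans (le_max_left _ _) hN
  have hN2 : N ≥ N₂ := le_trans ((le_max_left _ _).trans (le_max_right _ _)) hN
  have hN3 : N ≥ N₃ := le_trans ((le_max_right _ _).trans (le_max_right _ _)) hN
  haveI := hP N
  -- the pointwise split in `ℝ≥0∞`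
  have hpt : ∀ w, ENNReal.ofReal |D N w| ≤
      ENNReal.ofReal (c₀ + 2 * κ) + ENNReal.ofReal (1 / (4 * κ)) * ENNReal.ofReal (T N w ^ 2) +
        ENNReal.ofReal (1 / (4 * κ)) * ENNReal.ofReal (T' N w ^ 2) +
        (Bad N).indicator (fun _ => ENNReal.ofReal c₃) w +
        ENNReal.ofReal (c₂ / (2 * lam)) * ENNReal.ofReal (V N w ^ 2) := by
    intro w
    have hind : (Bad N).indicator (fun _ => ENNReal.ofReal c₃) w =
        ENNReal.ofReal ((Bad N).indicator (fun _ => c₃) w) := by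
      by_cases hw : w ∈ Bad N
      · rw [indicator_of_mem hw, indicator_of_mem hw]
      · rw [indicator_of_notMem hw, indicator_of_notMem hw, ENNReal.ofReal_zero]
    rw [hind, ← ENNReal.ofReal_mul (by positivity), ← ENNReal.ofReal_mul (by positivity),
      ← ENNReal.ofReal_mul (by positivity)]
    refine ofReal_le_add_five (by positivity) (by positivity) (by positivity)
      (Set.indicator_nonneg (fun _ _ => hc₃0) _) (by positivity) ?_
    have h1 : |T N w| ≤ κ + T N w ^ 2 / (4 * κ) := abs_le_add_sq_div hκ0
    have h2 : |T' N w| ≤ κ + T' N w ^ 2 / (4 * κ) := abs_le_add_sq_div hκ0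
    have h3 : (Bad N).indicator (fun w => c₁ + c₂ * V N w) w ≤
        (Bad N).indicator (fun _ => c₃) w + c₂ / (2 * lam) * V N w ^ 2 := by
      by_cases hw : w ∈ Bad N
      · rw [indicator_of_mem hw, indicator_of_mem hw, hc₃]
        have hv := le_half_add_sq_div_two_mul (y := V N w) hlam0
        have : c₂ * V N w ≤ c₂ * (lam / 2 + V N w ^ 2 / (2 * lam)) :=
          mul_le_mul_of_nonneg_left hv hc₂
        have e : c₂ * (lam / 2 + V N w ^ 2 / (2 * lam)) =
            c₂ * (lam / 2) + c₂ / (2 * lam) * V N w ^ 2 := by ring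
        linarith
      · rw [indicator_of_notMem hw, indicator_of_notMem hw, zero_add]
        positivity
    have e1 : 1 / (4 * κ) * T N w ^ 2 = T N w ^ 2 / (4 * κ) := by ring
    have e2 : 1 / (4 * κ) * T' N w ^ 2 = T' N w ^ 2 / (4 * κ) := by ring
    rw [e1, e2]
    linarith [hD N w]
  -- measurability of the pieces
  have hm1 : Measurable fun w => ENNReal.ofReal (1 / (4 * κ)) * ENNReal.ofReal (T N w ^ 2) :=
    ((hT N).pow_const 2).ennreal_ofReal.const_mul _
  have hm2 : Measurable fun w => ENNReal.ofReal (1 / (4 * κ)) * ENNReal.ofReal (T' N w ^ 2) :=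
    ((hT' N).pow_const 2).ennreal_ofReal.const_mul _
  have hm3 : Measurable fun w => (Bad N).indicator (fun _ => ENNReal.ofReal c₃) w :=
    measurable_const.indicator (hBad N)
  have hm4 : Measurable fun w => ENNReal.ofReal (c₂ / (2 * lam)) * ENNReal.ofReal (V N w ^ 2) :=
    ((hV N).pow_const 2).ennreal_ofReal.const_mul _
  -- integrate
  have hI := lintegral_mono (μ := P N) hpt
  rw [lintegral_add_right _ hm4, lintegral_add_right _ hm3, lintegral_add_right _ hm2,
    lintegral_add_right _ hm1, lintegral_const, measure_univ, mul_one,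
    lintegral_const_mul _ ((hT N).pow_const 2).ennreal_ofReal,
    lintegral_const_mul _ ((hT' N).pow_const 2).ennreal_ofReal,
    lintegral_indicator_const (hBad N),
    lintegral_const_mul _ ((hV N).pow_const 2).ennreal_ofReal] at hI
  refine hI.trans ?_
  -- bound the four vanishing / small terms by `η/8` each
  have b1 : ENNReal.ofReal (1 / (4 * κ)) * ∫⁻ w, ENNReal.ofReal (T N w ^ 2) ∂P N ≤
      ENNReal.ofReal (η / 8) := by
    calc ENNReal.ofReal (1 / (4 * κ)) * ∫⁻ w, ENNReal.ofReal (T N w ^ 2) ∂P N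
        ≤ ENNReal.ofReal (1 / (4 * κ)) * ENNReal.ofReal (κ * (η / 2)) := by
          gcongr
          exact hN₁ N hN1
      _ = ENNReal.ofReal (η / 8) := by
          rw [← ENNReal.ofReal_mul (by positivity)]
          congr 1
          field_simp
          ring
  have b2 : ENNReal.ofReal (1 / (4 * κ)) * ∫⁻ w, ENNReal.ofReal (T' N w ^ 2) ∂P N ≤
      ENNReal.ofReal (η / 8) := by
    calc ENNReal.ofReal (1 / (4 * κ)) * ∫⁻ w, ENNReal.ofReal (T' N w ^ 2) ∂P N
        ≤ ENNReal.ofReal (1 / (4 * κ)) * ENNReal.ofReal (κ * (η / 2)) := by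
          gcongr
          exact hN₂ N hN2
      _ = ENNReal.ofReal (η / 8) := by
          rw [← ENNReal.ofReal_mul (by positivity)]
          congr 1
          field_simp
          ring
  have b3 : ENNReal.ofReal c₃ * P N (Bad N) ≤ ENNReal.ofReal (η / 8) := by
    calc ENNReal.ofReal c₃ * P N (Bad N)
        ≤ ENNReal.ofReal c₃ * ENNReal.ofReal (η / (8 * (c₃ + 1))) := by
          gcongr
          exact hN₃ N hN3
      _ = ENNReal.ofReal (c₃ * (η / (8 * (c₃ + 1)))) := (ENNReal.ofReal_mul hc₃0).symm
      _ ≤ ENNReal.ofReal (η / 8) := by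
          refine ENNReal.ofReal_le_ofReal ?_
          rw [mul_div_assoc', div_le_div_iff₀ (by positivity) (by positivity)]
          nlinarith
  have b4 : ENNReal.ofReal (c₂ / (2 * lam)) * ∫⁻ w, ENNReal.ofReal (V N w ^ 2) ∂P N ≤
      ENNReal.ofReal (η / 8) := by
    calc ENNReal.ofReal (c₂ / (2 * lam)) * ∫⁻ w, ENNReal.ofReal (V N w ^ 2) ∂P N
        ≤ ENNReal.ofReal (c₂ / (2 * lam)) * ENNReal.ofReal K := by
          gcongr
          exact hVK N
      _ = ENNReal.ofReal (c₂ / (2 * lam) * K) := (ENNReal.ofReal_mul (by positivity)).symm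
      _ ≤ ENNReal.ofReal (η / 8) := by
          refine ENNReal.ofReal_le_ofReal ?_
          rw [div_mul_eq_mul_div, div_le_div_iff₀ (by positivity) (by positivity)]
          have h2 : η * (2 * lam) = 2 * (4 * c₂ * K + η) := by rw [← hlamη]; ring
          rw [h2]
          nlinarith
  calc ENNReal.ofReal (c₀ + 2 * κ) +
        ENNReal.ofReal (1 / (4 * κ)) * ∫⁻ w, ENNReal.ofReal (T N w ^ 2) ∂P N +
        ENNReal.ofReal (1 / (4 * κ)) * ∫⁻ w, ENNReal.ofReal (T' N w ^ 2) ∂P N +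
        ENNReal.ofReal c₃ * P N (Bad N) +
        ENNReal.ofReal (c₂ / (2 * lam)) * ∫⁻ w, ENNReal.ofReal (V N w ^ 2) ∂P N
      ≤ ENNReal.ofReal (c₀ + 2 * κ) + ENNReal.ofReal (η / 8) + ENNReal.ofReal (η / 8) +
          ENNReal.ofReal (η / 8) + ENNReal.ofReal (η / 8) := by
        gcongr
    _ = ENNReal.ofReal (c₀ + 2 * κ + η / 8 + η / 8 + η / 8 + η / 8) :=
        ofReal_add_five (by positivity) (by positivity) (by positivity) (by positivity)
          (by positivity)
    _ ≤ ENNReal.ofReal (c₀ + η) := ENNReal.ofReal_le_ofReal (by rw [hκ]; linarith)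

end Summit.AtomisticToContinuum.HydrodynamicLimit.Theorems.EvenStressEnskog

end
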